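import Mathlib
import HarnessLib
import HarnessLib.Audit
import Summits.PneNP.PneNP.Theses.BorrowedMemory
import Literature.Computability.Complexity.CatalyticSpace
import Literature.Computability.Complexity.CircuitEval

/-!
# Line `birth` — BC3 skeleton for the crux `PolyTimeIsCatalytic` (stmt-PneNP-18880)

Route `BorrowedMemory` (route-PneNP-BorrowedMemory), crux (rank 2) `PolyTimeIsCatalytic` = `P ⊆ CL`:
every language of Cook's class `P` (`PNPWave0.P Bool`, Mathlib `FinTM2` polynomial time) is decided by a
catalytic logspace machine — the route's inline `let InCL`, which is VERBATIM the Literature predicate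
`Literature.Computability.Complexity.InCL` (`CatalyticSpace.lean`), so that
`PolyTimeIsCatalytic ↔ PNPWave0.P Bool ⊆ CL` is `Iff.rfl` (`polyTimeIsCatalytic_iff` below). OPEN PROBLEM
in print, both ways ("the key open problem being the relationship of CL to P", arXiv:2504.17412 p. 2;
BCKLS 2014 §8).

THE LINE = THE ROUTE'S OWN FORESEEN SPLIT 1 (route header, TWO-LAYER PLAN: "PolyTimeIsCatalytic ⇐
ClosureUnderLogspaceReductions → HardLanguageIsCatalytic → PolyTimeIsCatalytic"), i.e. the `CL`-analogue
of Arora–Barak's Theorem 6.29 ("if `L` is P-complete then `L ∈ NC` iff `P = NC`; `L ∈ L` iff `P = L`")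
with the tree's OWN P-complete language, the circuit-evaluation language `CircEval.EvalLang`
(`CircuitEval.lean`: `{z | evalFn z = [true]}`, the evaluator of `⟨x, desc C⟩`; `EvalLang_mem_P`), cut
into its three genuine ingredients. Logspace reducibility is Arora–Barak's Def. 4.16 (IMPLICITLY
logspace computable `f`: polynomially bounded, and the bit language `{⟨x,i⟩ | f(x)_i = 1}` and the length
language `{⟨x,i⟩ | i < |f(x)|}` are in `L`), typed over the tree's `LOGSPACE` (`Space.lean`), pairing
`boolPair` (`BoolEncodings.lean`) and `Computability.encodeNat` — the tree has no logspace transducers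
(`Space.lean`, module docstring: "there is no FL/log-space transducer in v0"), and the bit-language form
needs none.

* `stub_closureUnderLogspaceReductions` — `CL` IS CLOSED UNDER LOGSPACE MANY-ONE REDUCTIONS (known,
  size L–XL in Lean): if `f` is implicitly logspace computable, `x ∈ L₁ ↔ f x ∈ L₂` and `L₂ ∈ CL` then
  `L₁ ∈ CL`. In print: BCKLS 2014, §4.1 p. 12 ("in the same way in which one can compose logspace
  reductions, we can compose constantly many reductions running in catalytic logspace … the same
  auxiliary space can be reused by each of the reductions, since it is returned to its original content
  after each use"); the composition is Arora–Barak Lemma 4.17 / Fig. 4.3 (recompute the bit `f(x)_j`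
  under the simulated input head in clean logspace; the head position `j ≤ |f(x)| ≤ q(|x|)` costs
  `O(log |x|)` clean bits). Machine surgery over `SpaceMachine` with one genuine subtlety recorded in the
  stub's docstring (the simulated machine's catalytic length `p₂(|f x|)` varies with `x`, not only with
  `|x|`: keep a virtual bottom-of-tape counter in clean logspace and run it on a prefix of `τ`).
* `stub_evalLangHardForP` — `EvalLang` IS HARD FOR `P` UNDER LOGSPACE REDUCTIONS (known: Ladner 1975;
  Arora–Barak Thm. 6.30 "CIRCUIT-EVAL is P-complete", proof: "a logspace reduction from any other
  language in P … is implicit in the proof of Theorem 6.15", the tableau; size XL in Lean): every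
  `L ∈ PNPWave0.P Bool` has an implicitly-logspace `f` with `x ∈ L ↔ f x ∈ EvalLang`. Intended witness:
  `f x = boolPair x (desc C_{|x|})` for a logspace-uniform version of the tree's tableau circuits
  (`P_subset_PPoly_holds`, `CircuitClassesUniformProofs.lean` / `TM2Circuits.lean`, fan-in ≤ 2 as
  `evalFn_boolPair_desc` requires; `PNPWave0.P Bool = Classes.P` is `p_bool_eq`, `CookBridges.lean`,
  conjecture-free cone). The uniformity of that family is the whole content.
* `stub_evalLangCatalytic` — THE OPEN CORE: `EvalLang ∈ CL` (the circuit value problem is decidable in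
  catalytic logspace). By stubs 1–2 it implies the crux; conversely the crux gives it at once
  (`EvalLang ∈ P`), so modulo two KNOWN theorems it is the crux made CONCRETE: one explicit language —
  iterated gate evaluation `⟨x, desc C⟩ ↦ C(x)` — exposed to the catalytic toolbox (register programs /
  transparent computation, BCKLS §4–5: `TC¹ ⊆ CL`; Cook–Mertz catalytic tree evaluation; the `SAC²`
  frontier of arXiv:2504.17412 Thm. 1.1). Not a costume: the cheap probes `stub → crux`, `stub → PneNP`
  fail (below), and the two other stubs are theorems of size L–XL absent from the tree.
* the SEAM `polyTimeIsCatalytic_of_sigs : Sig₁ → Sig₂ → Sig₃ → PNPWave0.P Bool ⊆ CL` — three lines of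
  logic (for `L ∈ P` take the reduction `f` to `EvalLang`, apply closure) — and THE SKELETON THEOREM
  `PolyTimeIsCatalytic_of : PolyTimeIsCatalytic`, the crux BY NAME from the three declared stubs (the
  file's only `sorry`s) through `polyTimeIsCatalytic_iff` (`Iff.rfl`); it is the file's only theorem
  whose head is the crux name (what `ledger skeleton check` keys on).

Disproof used: none exists for this crux (`ledger crux ls stmt-PneNP-18880`: no workfiles before this
one, no Disproof.lean, no crux ideas, 2026-08-17). Negatives honoured: `ledger negatives --problem PneNP`
has no space-bounded statement (refuter ATTACK.md on the item, 2026-08-17: crux survives, `Iff.rfl` with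
`P Bool ⊆ CL`, hypotheses inhabited, `InCL` loophole audit clean). Typing checklist 4c: no thresholds,
no integrals, no determinantal or partition-function claims; every stub keeps `∃ p` / `∃ c` free.
BC3 probes (seat folder `bc/probe_*.lean`): `stub → PolyTimeIsCatalytic` and `stub → PneNP` by
`first | exact? | simpa | aesop` FAIL for all three stubs (outputs in the seat's NOTES.md and in
`Lines/birth.md`). Import cone: `CircuitEval.lean` + `CatalyticSpace.lean` do not reach
`ClayProblem.lean` / `NPNotSubsetPPoly` (checked: unknown identifier). Planner
planner-skel-stmt-PneNP-18880-0, 2026-08-17.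
-/

set_option linter.dupNamespace false
set_option linter.unusedVariables false

namespace Summit.PneNP.PneNP.Cruxes.PolyTimeIsCatalytic.Birth

open Literature.Computability.Complexity
open Summit.PneNP.PneNP.Theses.BorrowedMemory

/-! ## The three registered stubs -/

/-- **Stub 1 (closure of `CL` under logspace many-one reductions; known, size L–XL).** If
`f : {0,1}* → {0,1}*` is implicitly logspace computable in the sense of Arora–Barak Def. 4.16 —
polynomially bounded, with the length language `{⟨x,i⟩ | i < |f x|}` and the bit language
`{⟨x,i⟩ | (f x)_i = 1}` in `LOGSPACE` (pairs `boolPair x (encodeNat i)`) — and `x ∈ L₁ ↔ f x ∈ L₂` for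
all `x`, then `L₂ ∈ CL → L₁ ∈ CL`. Proof in print: simulate the catalytic machine `M₂` for `L₂` on the
virtual input `f x`, recomputing the bit under its input head by the logspace bit-decider whenever it is
read (Arora–Barak Lemma 4.17, Fig. 4.3); the catalytic tape is `M₂`'s own and is restored by `M₂`; clean
space `O(log q(|x|)) + O(log |x|) = O(log |x|)`. Subtlety of the stack rendering: `M₂` expects a
catalytic content of length exactly `p₂(|f x|)`, which depends on `x` and not only on `|x|` — take
`p₁ := p₂ ∘ q`-dominating, run `M₂` on the top `p₂(|f x|)` cells of `τ` and keep a virtual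
bottom-of-tape counter (`O(log)` clean bits), never touching the rest. [cite: BuhrmanEtAl2014, §4.1
p. 12 (composition of catalytic logspace reductions)] [cite: AroraBarak2009, Def. 4.16, Lem. 4.17] -/
theorem stub_closureUnderLogspaceReductions :
    ∀ (L₁ L₂ : Language Bool) (f : List Bool → List Bool),
      (∃ p : Polynomial ℕ, ∀ x : List Bool, (f x).length ≤ p.eval x.length) →
      {w : List Bool | ∃ (x : List Bool) (i : ℕ), w = Literature.Computability.Complexity.boolPair x (Computability.encodeNat i) ∧ i < (f x).length} ∈ Literature.Computability.Complexity.LOGSPACE →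
      {w : List Bool | ∃ (x : List Bool) (i : ℕ), w = Literature.Computability.Complexity.boolPair x (Computability.encodeNat i) ∧ (f x).getD i false = true} ∈ Literature.Computability.Complexity.LOGSPACE →
      (∀ x : List Bool, x ∈ L₁ ↔ f x ∈ L₂) →
      L₂ ∈ Literature.Computability.Complexity.CL → L₁ ∈ Literature.Computability.Complexity.CL := by
  sorry

/-- **Stub 2 (`EvalLang` is hard for `P` under logspace reductions = Ladner's theorem for the tree's
circuit-evaluation language; known, size XL).** Every language of Cook's `P` (`PNPWave0.P Bool`;
`= Classes.P` by `p_bool_eq`, `CookBridges.lean`) reduces to `CircEval.EvalLang = {z | evalFn z = [true]}`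
by an implicitly logspace computable `f` (Arora–Barak Def. 4.16, typed as in Stub 1). Intended witness:
`f x = boolPair x (desc C_{|x|})` for a LOGSPACE-UNIFORM family of fan-in-2 tableau circuits of the
polynomial-time `FinTM2` deciding `L` (`evalFn_boolPair_desc`: `evalFn ⟨x, desc C⟩ = [C(x)]`; the
non-uniform family exists in the tree, `P_subset_PPoly_holds`); the content is the uniformity — each
bit of `desc C_n` (unary depth codes `ROT^e READ BACK^e` and 4-bit gate tables, `CircEval.desc`) is
computable from `⟨x, i⟩` in space `O(log |x|)`. [cite: Ladner1975CVP] [cite: AroraBarak2009, Def. 6.28,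
Thm. 6.30 (CIRCUIT-EVAL is P-complete; proof via Thm. 6.15)] -/
theorem stub_evalLangHardForP :
    ∀ L : Language Bool, L ∈ Literature.Computability.Complexity.PNPWave0.P Bool →
      ∃ f : List Bool → List Bool,
        (∃ p : Polynomial ℕ, ∀ x : List Bool, (f x).length ≤ p.eval x.length) ∧
        {w : List Bool | ∃ (x : List Bool) (i : ℕ), w = Literature.Computability.Complexity.boolPair x (Computability.encodeNat i) ∧ i < (f x).length} ∈ Literature.Computability.Complexity.LOGSPACE ∧
        {w : List Bool | ∃ (x : List Bool) (i : ℕ), w = Literature.Computability.Complexity.boolPair x (Computability.encodeNat i) ∧ (f x).getD i false = true} ∈ Literature.Computability.Complexity.LOGSPACE ∧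
        ∀ x : List Bool, x ∈ L ↔ f x ∈ Literature.Computability.Complexity.CircEval.EvalLang := by
  sorry

/-- **Stub 3 (THE OPEN CORE: the circuit value problem is in catalytic logspace; open problem, size
XXL).** `CircEval.EvalLang ∈ CL`. With Stubs 1–2 it gives the crux (this file); conversely the crux gives
it at once (`EvalLang ∈ P`, `EvalLang_mem_P` + `p_bool_eq`) — the `CL`-analogue of Arora–Barak Thm. 6.29.
Engines in print that decide structured sub-families of `EvalLang` catalytically: register programs /
transparent computation over rings (`TC¹ ⊆ CL`, BCKLS Thm. 17), catalytic tree evaluation (Cook–Mertz),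
`SAC² ⊆ CSPACE(log² n / log log n, 2^{O(log^{1+ε} n)})` (arXiv:2504.17412 Thm. 1.1); none handles
polynomial depth. Any proof is a theorem `P ⊆ CL`, hence news; a refutation (`EvalLang ∉ CL`) is
`P ⊄ CL`, closing the route (`close --reason refuted:PolyTimeIsCatalytic`). [cite: BuhrmanEtAl2014, §8
(open problems: CL vs P)] [cite: AroraBarak2009, Thm. 6.29, Thm. 6.30] -/
theorem stub_evalLangCatalytic :
    Literature.Computability.Complexity.CircEval.EvalLang ∈ Literature.Computability.Complexity.CL := by
  sorry

/-! ## The composition (sorry-free) -/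

/-- **Composition with explicit hypotheses** (BC3 shape `closure → hardness → core → (P ⊆ CL)`; the
conclusion is the by-name form of the crux body, `polyTimeIsCatalytic_iff`). For `L ∈ P` take the
logspace reduction `f` of `L` to `EvalLang` (hardness) and pull `EvalLang ∈ CL` back along it (closure).
[cite: AroraBarak2009, Thm. 6.29 (proof pattern)] -/
theorem polyTimeIsCatalytic_of_sigs
    (hC : ∀ (L₁ L₂ : Language Bool) (f : List Bool → List Bool),
      (∃ p : Polynomial ℕ, ∀ x : List Bool, (f x).length ≤ p.eval x.length) →
      {w : List Bool | ∃ (x : List Bool) (i : ℕ), w = boolPair x (Computability.encodeNat i) ∧ i < (f x).length} ∈ LOGSPACE →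
      {w : List Bool | ∃ (x : List Bool) (i : ℕ), w = boolPair x (Computability.encodeNat i) ∧ (f x).getD i false = true} ∈ LOGSPACE →
      (∀ x : List Bool, x ∈ L₁ ↔ f x ∈ L₂) → L₂ ∈ CL → L₁ ∈ CL)
    (hH : ∀ L : Language Bool, L ∈ PNPWave0.P Bool →
      ∃ f : List Bool → List Bool,
        (∃ p : Polynomial ℕ, ∀ x : List Bool, (f x).length ≤ p.eval x.length) ∧
        {w : List Bool | ∃ (x : List Bool) (i : ℕ), w = boolPair x (Computability.encodeNat i) ∧ i < (f x).length} ∈ LOGSPACE ∧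
        {w : List Bool | ∃ (x : List Bool) (i : ℕ), w = boolPair x (Computability.encodeNat i) ∧ (f x).getD i false = true} ∈ LOGSPACE ∧
        ∀ x : List Bool, x ∈ L ↔ f x ∈ CircEval.EvalLang)
    (hE : CircEval.EvalLang ∈ CL) :
    PNPWave0.P Bool ⊆ CL := by
  intro L hL
  obtain ⟨f, hp, hlen, hbit, hred⟩ := hH L hL
  exact hC L CircEval.EvalLang f hp hlen hbit hred hE

/-- The crux BY NAME is definitionally `P ⊆ CL`: the route's inline `let InCL` is the Literature
predicate `InCL` verbatim (`CatalyticSpace.lean`, module docstring; grounder evidence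
`CatalyticSpaceBridge.lean` on stmt-PneNP-19092). [folklore] -/
theorem polyTimeIsCatalytic_iff : PolyTimeIsCatalytic ↔ PNPWave0.P Bool ⊆ CL := Iff.rfl

/-- **THE SKELETON THEOREM.** The crux `Summit.PneNP.PneNP.Theses.BorrowedMemory.PolyTimeIsCatalytic`,
concluded BY NAME from the three DECLARED stubs `stub_closureUnderLogspaceReductions`,
`stub_evalLangHardForP`, `stub_evalLangCatalytic` (the only `sorry`s of the file) through the sorry-free
composition `polyTimeIsCatalytic_of_sigs` and `polyTimeIsCatalytic_iff`. [folklore] -/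
theorem PolyTimeIsCatalytic_of : Summit.PneNP.PneNP.Theses.BorrowedMemory.PolyTimeIsCatalytic :=
  polyTimeIsCatalytic_iff.2
    (polyTimeIsCatalytic_of_sigs stub_closureUnderLogspaceReductions stub_evalLangHardForP
      stub_evalLangCatalytic)

end Summit.PneNP.PneNP.Cruxes.PolyTimeIsCatalytic.Birth
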